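import Summits.QuantumFields.YangMills.Theorems.UnitScaleTiltProp7SectET3HilbertLettersT3
import HarnessLib

/-!
# Route `UnitScaleTilt`, crux «MinimiserStabilityRegPr» (stmt-QuantumFields-19200), stub `stub_existenceMinimalOrbit` (EX), pen (b1) glue —
# **THE 𝔲(2) ⊕ i𝔲(2) SPLIT OF AN `M₂(ℂ)` CARRIER AND FROBENIUS PYTHAGORAS FOR STAR-COMPATIBLE ℂ-LINEAR MAPS: A COMPARISON ROW PROVED ON
# ANTI-HERMITIAN CARRIERS HOLDS ON ALL CARRIERS WITH THE SAME CONSTANTS**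

Cell `ym3-torus`, twin-width seat `ym-ust-19200-w7` (gen 10).  THEOREMS ONLY (0 `def`, 0 `sorry`); `--supports stmt-QuantumFields-19200 --as helper`, count-neutral.
YM₃ on T³ is ladder rung R3 — NOT d = 4, NOT infinite volume, NOT a mass gap, NOT Clay; nothing here claims a print row, the stub or the crux.

WHY (LOCATE-QCMP-B1-w7g10 §§4–5).  The tube-comparison row `hQcmp` of ✓`Prop7TransverseRowOfQTwSTubeComparison` ∕ ✓`Prop7TransverseRowOfTubeRowRegPr` is displayed for
EVERY `M₂(ℂ)`-valued carrier, while the located supplier route through ✓`Prop7QSymEqTrueLinIter.QTwS_apply_eq_trueLinIter_sub_coarseGauge` is stated on 𝔰𝔲(2)-valued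
directions.  This file is the generic glue: `M₂(ℂ) = 𝔲(2) ⊕ i·𝔲(2)` (`X = ½(X − Xᴴ) + i·(−(i/2)(X + Xᴴ))`, both parts anti-Hermitian), and for ℂ-linear maps `T` that commute
with the bondwise conjugate transpose, `‖T(A + iB)‖_F² = ‖TA‖_F² + ‖TB‖_F²` whenever `A, B` are anti-Hermitian fields (the cross term is `Re(i·tr((TA)ᴴ(TB)))` and `tr(MN)` is
REAL for anti-Hermitian `M, N`).  Consequently a row `Σ‖T X‖_F² ≤ α·Σ‖Q X‖_F² + β·Σ‖X‖_F²` proved for anti-Hermitian carriers holds for all carriers (§3), constants unchanged.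
[Balaban1985Averaging] (18)–(20) p.21 (Frobenius vs operator norms on `M_N(ℂ)`); [Balaban1985BackgroundPropagators] §3 works with the complexified real operators throughout.
-/

set_option autoImplicit false

noncomputable section

open scoped BigOperators ComplexConjugate InnerProductSpace Matrix

namespace Summit.QuantumFields.YangMills.Theorems.Prop7SkewSplitFrobeniusRow

open Summit.QuantumFields.YangMills.Theorems.Prop7SectET3HilbertLetters (W₂ frobEquiv inner_frobEquiv_symm)
open Complex (I)

/-! ## §1 Traces of products of anti-Hermitian matrices are real; Frobenius Pythagoras -/

/-- `tr(M N)` is REAL (`star`-fixed) when `Mᴴ = −M`, `Nᴴ = −N` (the `ᴴ`-spelling of ✓`Prop7QTwSectors.star_trace_mul_of_skew`, whose `star`-spelling lives in a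
module with a heavy import cone; 2 lines, kept local under a distinct name). [cite: Balaban1985Averaging, (18) p.21] -/
theorem star_trace_mul_of_conjTranspose_eq_neg {M N : Matrix (Fin 2) (Fin 2) ℂ} (hM : Mᴴ = -M) (hN : Nᴴ = -N) :
    star (Matrix.trace (M * N)) = Matrix.trace (M * N) := by
  rw [← Matrix.trace_conjTranspose, Matrix.conjTranspose_mul, hM, hN, neg_mul_neg, Matrix.trace_mul_comm]

/-- The Frobenius pairing of anti-Hermitian matrices is real: `⟪M, N⟫_F = −tr(M N)` and `star ⟪M, N⟫_F = ⟪M, N⟫_F`. [cite: Balaban1985Averaging, (18) p.21] -/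
theorem star_inner_frob_of_skew {M N : Matrix (Fin 2) (Fin 2) ℂ} (hM : Mᴴ = -M) (hN : Nᴴ = -N) :
    star ⟪(frobEquiv.symm M : W₂), frobEquiv.symm N⟫_ℂ = ⟪(frobEquiv.symm M : W₂), frobEquiv.symm N⟫_ℂ := by
  rw [inner_frobEquiv_symm, hM, neg_mul, Matrix.trace_neg, star_neg, star_trace_mul_of_conjTranspose_eq_neg hM hN]

/-- ★★ **FROBENIUS PYTHAGORAS ACROSS `𝔲(2) ⊕ i𝔲(2)`**: for anti-Hermitian `M, N`, `‖M + i·N‖_F² = ‖M‖_F² + ‖N‖_F²`. [cite: Balaban1985Averaging, (18)-(20) p.21] -/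
theorem norm_sq_frob_add_I_smul_of_skew {M N : Matrix (Fin 2) (Fin 2) ℂ} (hM : Mᴴ = -M) (hN : Nᴴ = -N) :
    ‖(frobEquiv.symm (M + I • N) : W₂)‖ ^ 2 = ‖(frobEquiv.symm M : W₂)‖ ^ 2 + ‖(frobEquiv.symm N : W₂)‖ ^ 2 := by
  have hreal := star_inner_frob_of_skew hM hN
  set z : ℂ := ⟪(frobEquiv.symm M : W₂), frobEquiv.symm N⟫_ℂ with hz
  have him : z.im = 0 := by
    have h := congrArg Complex.im hreal
    rw [Complex.star_def, Complex.conj_im] at h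
    linarith
  rw [map_add, map_smul, @norm_add_sq ℂ, norm_smul, Complex.norm_I, one_mul, inner_smul_right, ← hz]
  have : RCLike.re (I * z) = -z.im := by simp
  rw [this, him]; ring

/-! ## §2 The split `X = ½(X − Xᴴ) + i·(−(i/2)(X + Xᴴ))` -/

/-- The anti-Hermitian part `½(X − Xᴴ)` is anti-Hermitian. [cite: Balaban1985Averaging, (18) p.21] -/
theorem conjTranspose_skewPart (X : Matrix (Fin 2) (Fin 2) ℂ) :
    ((2 : ℂ)⁻¹ • (X - Xᴴ))ᴴ = -((2 : ℂ)⁻¹ • (X - Xᴴ)) := by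
  rw [Matrix.conjTranspose_smul, Matrix.conjTranspose_sub, Matrix.conjTranspose_conjTranspose]
  have h2 : star (2 : ℂ)⁻¹ = (2 : ℂ)⁻¹ := by simp
  rw [h2, ← smul_neg, neg_sub]

/-- The `i`-rotated Hermitian part `−(i/2)(X + Xᴴ)` is anti-Hermitian. [cite: Balaban1985Averaging, (18) p.21] -/
theorem conjTranspose_coskewPart (X : Matrix (Fin 2) (Fin 2) ℂ) :
    ((-(I / 2)) • (X + Xᴴ))ᴴ = -((-(I / 2)) • (X + Xᴴ)) := by
  rw [Matrix.conjTranspose_smul, Matrix.conjTranspose_add, Matrix.conjTranspose_conjTranspose, add_comm Xᴴ X, ← neg_smul]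
  congr 1
  rw [star_neg, neg_neg, star_div₀, Complex.star_def, Complex.conj_I, map_ofNat, neg_div, neg_neg]

/-- ★ **THE SPLIT**: `X = ½(X − Xᴴ) + i·(−(i/2)(X + Xᴴ))`. [cite: Balaban1985Averaging, (18) p.21] -/
theorem skewPart_add_I_smul_coskewPart (X : Matrix (Fin 2) (Fin 2) ℂ) :
    (2 : ℂ)⁻¹ • (X - Xᴴ) + I • ((-(I / 2)) • (X + Xᴴ)) = X := by
  rw [smul_smul, show I * -(I / 2) = (2 : ℂ)⁻¹ by rw [mul_neg, mul_div_assoc', Complex.I_mul_I]; norm_num, ← smul_add,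
    sub_add_add_cancel, ← two_smul ℂ X, smul_smul]
  norm_num

/-- Frobenius Pythagoras for the split of a single matrix: `‖X‖_F² = ‖½(X − Xᴴ)‖_F² + ‖−(i/2)(X + Xᴴ)‖_F²`. [cite: Balaban1985Averaging, (18)-(20) p.21] -/
theorem norm_sq_frob_eq_skewPart_add_coskewPart (X : Matrix (Fin 2) (Fin 2) ℂ) :
    ‖(frobEquiv.symm X : W₂)‖ ^ 2
      = ‖(frobEquiv.symm ((2 : ℂ)⁻¹ • (X - Xᴴ)) : W₂)‖ ^ 2 + ‖(frobEquiv.symm ((-(I / 2)) • (X + Xᴴ)) : W₂)‖ ^ 2 := by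
  conv_lhs => rw [← skewPart_add_I_smul_coskewPart X]
  exact norm_sq_frob_add_I_smul_of_skew (conjTranspose_skewPart X) (conjTranspose_coskewPart X)

/-! ## §3 Star-compatible ℂ-linear maps: rows extend from anti-Hermitian carriers to all carriers -/

variable {β γ δ : Type*} [Fintype β] [Fintype γ] [Fintype δ]

omit [Fintype β] [Fintype γ] in
/-- A ℂ-linear map of matrix fields that commutes with the bondwise conjugate transpose sends anti-Hermitian fields to anti-Hermitian fields.
[cite: Balaban1985BackgroundPropagators, (3.14)-(3.15) p.393] -/
theorem conjTranspose_apply_of_skew (T : (β → Matrix (Fin 2) (Fin 2) ℂ) →ₗ[ℂ] (γ → Matrix (Fin 2) (Fin 2) ℂ))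
    (hT : ∀ (X : β → Matrix (Fin 2) (Fin 2) ℂ) (c : γ), T (fun b => (X b)ᴴ) c = (T X c)ᴴ)
    {A : β → Matrix (Fin 2) (Fin 2) ℂ} (hA : ∀ b, (A b)ᴴ = -A b) (c : γ) : (T A c)ᴴ = -T A c := by
  rw [← hT]
  have : (fun b => (A b)ᴴ) = -A := by funext b; rw [hA]; rfl
  rw [this, map_neg]; rfl

omit [Fintype β] in
/-- ★★ **FROBENIUS PYTHAGORAS FOR A STAR-COMPATIBLE MAP**: `Σ_c ‖T(A + iB) c‖_F² = Σ_c ‖TA c‖_F² + Σ_c ‖TB c‖_F²` for anti-Hermitian fields `A, B`.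
[cite: Balaban1985Averaging, (18)-(20) p.21] -/
theorem sum_norm_sq_frob_apply_add_I_smul (T : (β → Matrix (Fin 2) (Fin 2) ℂ) →ₗ[ℂ] (γ → Matrix (Fin 2) (Fin 2) ℂ))
    (hT : ∀ (X : β → Matrix (Fin 2) (Fin 2) ℂ) (c : γ), T (fun b => (X b)ᴴ) c = (T X c)ᴴ)
    {A B : β → Matrix (Fin 2) (Fin 2) ℂ} (hA : ∀ b, (A b)ᴴ = -A b) (hB : ∀ b, (B b)ᴴ = -B b) :
    ∑ c, ‖(frobEquiv.symm (T (A + I • B) c) : W₂)‖ ^ 2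
      = ∑ c, ‖(frobEquiv.symm (T A c) : W₂)‖ ^ 2 + ∑ c, ‖(frobEquiv.symm (T B c) : W₂)‖ ^ 2 := by
  rw [← Finset.sum_add_distrib]
  refine Finset.sum_congr rfl fun c _ => ?_
  rw [map_add, map_smul, Pi.add_apply, Pi.smul_apply]
  exact norm_sq_frob_add_I_smul_of_skew (conjTranspose_apply_of_skew T hT hA c) (conjTranspose_apply_of_skew T hT hB c)

/-- ★★★ **A COMPARISON ROW ON ANTI-HERMITIAN CARRIERS HOLDS ON ALL CARRIERS** (same constants): for star-compatible ℂ-linear `T`, `Q` and `0 ≤ α, β`,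
`(∀ A anti-Hermitian, Σ_c‖TA c‖_F² ≤ α·Σ_d‖QA d‖_F² + βc·Σ_b‖A b‖_F²) → ∀ X, Σ_c‖TX c‖_F² ≤ α·Σ_d‖QX d‖_F² + βc·Σ_b‖X b‖_F²`.
[cite: Balaban1985Averaging, (18)-(20) p.21; Balaban1985BackgroundPropagators, (3.14)-(3.15) p.393] -/
theorem row_of_skew_row (T : (β → Matrix (Fin 2) (Fin 2) ℂ) →ₗ[ℂ] (γ → Matrix (Fin 2) (Fin 2) ℂ))
    (Q : (β → Matrix (Fin 2) (Fin 2) ℂ) →ₗ[ℂ] (δ → Matrix (Fin 2) (Fin 2) ℂ))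
    (hT : ∀ (X : β → Matrix (Fin 2) (Fin 2) ℂ) (c : γ), T (fun b => (X b)ᴴ) c = (T X c)ᴴ)
    (hQ : ∀ (X : β → Matrix (Fin 2) (Fin 2) ℂ) (d : δ), Q (fun b => (X b)ᴴ) d = (Q X d)ᴴ)
    (α βc : ℝ)
    (hrow : ∀ A : β → Matrix (Fin 2) (Fin 2) ℂ, (∀ b, (A b)ᴴ = -A b) →
      ∑ c, ‖(frobEquiv.symm (T A c) : W₂)‖ ^ 2 ≤ α * ∑ d, ‖(frobEquiv.symm (Q A d) : W₂)‖ ^ 2 + βc * ∑ b, ‖(frobEquiv.symm (A b) : W₂)‖ ^ 2)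
    (X : β → Matrix (Fin 2) (Fin 2) ℂ) :
    ∑ c, ‖(frobEquiv.symm (T X c) : W₂)‖ ^ 2 ≤ α * ∑ d, ‖(frobEquiv.symm (Q X d) : W₂)‖ ^ 2 + βc * ∑ b, ‖(frobEquiv.symm (X b) : W₂)‖ ^ 2 := by
  -- the split of the carrier
  set A : β → Matrix (Fin 2) (Fin 2) ℂ := fun b => (2 : ℂ)⁻¹ • (X b - (X b)ᴴ) with hAdef
  set B : β → Matrix (Fin 2) (Fin 2) ℂ := fun b => (-(I / 2)) • (X b + (X b)ᴴ) with hBdef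
  have hA : ∀ b, (A b)ᴴ = -A b := fun b => conjTranspose_skewPart (X b)
  have hB : ∀ b, (B b)ᴴ = -B b := fun b => conjTranspose_coskewPart (X b)
  have hX : A + I • B = X := by funext b; exact skewPart_add_I_smul_coskewPart (X b)
  -- the identity map is star-compatible: the carrier's own Pythagoras
  have hXsq : ∑ b, ‖(frobEquiv.symm (X b) : W₂)‖ ^ 2 = ∑ b, ‖(frobEquiv.symm (A b) : W₂)‖ ^ 2 + ∑ b, ‖(frobEquiv.symm (B b) : W₂)‖ ^ 2 := by
    rw [← Finset.sum_add_distrib]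
    exact Finset.sum_congr rfl fun b _ => norm_sq_frob_eq_skewPart_add_coskewPart (X b)
  rw [← hX, sum_norm_sq_frob_apply_add_I_smul T hT hA hB, sum_norm_sq_frob_apply_add_I_smul Q hQ hA hB, hX, hXsq, mul_add, mul_add]
  have h1 := hrow A hA
  have h2 := hrow B hB
  linarith

end Summit.QuantumFields.YangMills.Theorems.Prop7SkewSplitFrobeniusRow

end
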